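import Mathlib.RingTheory.MvPolynomial.WeightedHomogeneous
import Literature.AlgebraicGeometry.Resolution.WeightedBlowupMonomialValuation
import HarnessLib

/-!
# A change of parameters dominating the weights acts on `gr_J` by a graded automorphism

Model (as in `WeightedBlowupMonomialValuation`): `p` = the origin of `K[X_i : i ∈ σ]`, integer
weights `w : σ → ℕ` (`wᵢ = N/aᵢ`), `ν_w = monomialOrd w` the monomial valuation of the centre
`J = (Xᵢ^{aᵢ})` in integer normal form.  The valuation ideals `I_m = {F : m ≤ ν_w F}` are spanned
by the monomials of `w`-weight `≥ m` [ATW24, §3.4: `A_γ = ⊕_m I_m^γ`,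
`I_m^γ = (x^b | Σ wᵢbᵢ ≥ m)`], so the associated graded ring `gr_J = ⊕ I_m/I_{m+1}` is `K[X]`
with the `w`-grading, the class of `F ∈ I_m ∖ I_{m+1}` being its **initial form**
`in_w(F) = weightedHomogeneousComponent w (ν_w F) F` (for all weights `1` this is the initial
form `in_𝔪(F)` of [CJS20, §2.2]).

A second system of parameters `zᵢ = φ(Xᵢ)` (`φ` a `K`-algebra endomorphism) **dominating the
weights**, `wᵢ ≤ ν_w(zᵢ)`, induces the graded substitution
`θ_φ : Xᵢ ↦ in_w-part of weight wᵢ of zᵢ = weightedHomogeneousComponent w wᵢ (φ Xᵢ)`, and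

* §1 the lowest `w`-homogeneous components multiply (`gr_J` is a graded ring: products, powers,
  finite products; vanishing below the order);
* §2 **`weightedHomogeneousComponent w m (φ G) = θ_φ (weightedHomogeneousComponent w m G)` for
  every `m ≤ ν_w(G)`** — the weight-`m` layer of `φ G` only sees the initial parts of the new
  parameters; `θ_φ` is graded (maps `w`-homogeneous polynomials of weight `m` to such);
* §3 for a `K`-algebra AUTOMORPHISM `Ψ` of `K[X]` (`σ` finite, `K` a Noetherian domain) dominating
  the weights, rigidity [ATW24, Lemma 5.2.10; `monomialOrd_ringEquiv_eq`] gives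
  `ν_w(Ψ G) = ν_w(G)`, hence **`in_w(Ψ G) = θ_Ψ(in_w G)`**, and `θ_Ψ ∘ θ_{Ψ⁻¹} = id = θ_{Ψ⁻¹} ∘ θ_Ψ`:
  **`θ_Ψ` is a graded `K`-algebra automorphism of `gr_J` with inverse `θ_{Ψ⁻¹}`** — the two
  presentations of the same centre [ATW24, Thm. 5.3.1 (3): "the unique admissible center …
  independent of the maximal contact sequence"] differ by a graded automorphism of its graded
  algebra;
* §4 with all weights positive, `θ_Ψ` is **block triangular**: a monomial of weight `wᵢ` is either a
  single variable of weight `wᵢ` or involves only variables of weight `< wᵢ`, and the linear blocks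
  — the Jacobian matrices of `Ψ` and `Ψ⁻¹` at the origin cut down to the variables of one weight —
  are mutually inverse.

Conventions: no hypothesis on the characteristic; `θ_φ` is written out as
`aeval (fun i => weightedHomogeneousComponent w (w i) (φ (X i)))` (no new definitions).  For the
unweighted case in an abstract regular local ring (two regular systems of parameters induce a
LINEAR substitution on `gr_𝔪(R)`, [CoP1, proof of Prop. 4.2]) see
`InitialFormsChangeOfParameters`; for the top-weight block and the directrix see
`WeightedCentreDirectrix`.
-/

noncomputable section

open MvPolynomial
open Finsupp (weight)

namespace Literature.AlgebraicGeometry.Resolution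

namespace WeightedBlowup

variable {σ : Type*} {K : Type*} [CommRing K]

/-- `weight_w(d) = Σ_{i ∈ supp d} dᵢ·wᵢ`. [folklore] -/
private theorem weight_eq_sum (w : σ → ℕ) (d : σ →₀ ℕ) :
    weight w d = ∑ i ∈ d.support, d i * w i := by
  simp [Finsupp.weight_apply, Finsupp.sum, smul_eq_mul]

/-- The order of a product dominates the sum of the orders (finite products).
[cite: AbramovichTemkinWlodarczyk2024, Lemma 5.2.6 (p. 1577)] -/
private theorem sum_le_monomialOrd_finset_prod (w : σ → ℕ) {ι : Type*} (s : Finset ι)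
    (P : ι → MvPolynomial σ K) (a : ι → ℕ)
    (h : ∀ i ∈ s, (a i : ℕ∞) ≤ monomialOrd w (P i)) :
    ((∑ i ∈ s, a i : ℕ) : ℕ∞) ≤ monomialOrd w (∏ i ∈ s, P i) := by
  classical
  induction s using Finset.induction_on with
  | empty => simp
  | insert j s hjs ih =>
    rw [Finset.sum_insert hjs, Finset.prod_insert hjs, Nat.cast_add]
    exact le_trans (add_le_add (h j (Finset.mem_insert_self j s))
      (ih fun i hi => h i (Finset.mem_insert_of_mem hi))) (add_monomialOrd_le_mul _ _ _)

/-! ## §1 The graded ring `gr_J`: lowest `w`-homogeneous components multiply -/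

/-- Below the order every `w`-homogeneous component vanishes: `m < n ≤ ν_w(P)` ⟹ the weight-`m`
component of `P` is `0` (`P ∈ I_n ⊆ I_{m+1}`).
[cite: AbramovichTemkinWlodarczyk2024, §3.4 (p. 1570) (I_m^γ = (x^b | Σ wᵢbᵢ ≥ m))] -/
theorem weightedHomogeneousComponent_eq_zero_of_lt_monomialOrd (w : σ → ℕ) (P : MvPolynomial σ K)
    {m n : ℕ} (hmn : m < n) (hP : (n : ℕ∞) ≤ monomialOrd w P) :
    weightedHomogeneousComponent w m P = 0 := by
  rw [le_monomialOrd_iff] at hP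
  exact weightedHomogeneousComponent_eq_zero' m P fun d hd => by
    have := hP d hd
    omega

/-- The weight-`n` component lies in `I_n`: `n ≤ ν_w(weightedHomogeneousComponent w n P)`.
[cite: AbramovichTemkinWlodarczyk2024, §3.4 (p. 1570) (I_m^γ = (x^b | Σ wᵢbᵢ ≥ m))] -/
theorem le_monomialOrd_weightedHomogeneousComponent (w : σ → ℕ) (P : MvPolynomial σ K) (n : ℕ) :
    (n : ℕ∞) ≤ monomialOrd w (weightedHomogeneousComponent w n P) := by
  classical
  rw [le_monomialOrd_iff]
  intro d hd
  rw [mem_support_iff, coeff_weightedHomogeneousComponent] at hd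
  split_ifs at hd with h
  · exact h.ge
  · exact (hd rfl).elim

/-- What is left above the weight-`n` layer lies in `I_{n+1}`: `n ≤ ν_w P ⟹ n + 1 ≤
ν_w(P − weightedHomogeneousComponent w n P)`.
[cite: AbramovichTemkinWlodarczyk2024, §3.4 (p. 1570) (the filtration I_m^γ ⊇ I_{m+1}^γ)] -/
theorem succ_le_monomialOrd_sub_weightedHomogeneousComponent (w : σ → ℕ) (P : MvPolynomial σ K)
    {n : ℕ} (hP : (n : ℕ∞) ≤ monomialOrd w P) :
    ((n + 1 : ℕ) : ℕ∞) ≤ monomialOrd w (P - weightedHomogeneousComponent w n P) := by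
  classical
  rw [le_monomialOrd_iff] at hP ⊢
  intro d hd
  rw [mem_support_iff, coeff_sub, coeff_weightedHomogeneousComponent] at hd
  split_ifs at hd with h
  · exact (hd (sub_self _)).elim
  · have h1 : d ∈ P.support := by rw [mem_support_iff]; rwa [sub_zero] at hd
    have h2 := hP d h1
    omega

/-- **Initial forms multiply in `gr_J`:** if `a ≤ ν_w P` and `b ≤ ν_w Q` then the weight-`(a+b)`
component of `PQ` is the product of the weight-`a` component of `P` and the weight-`b` component
of `Q` (`I_a/I_{a+1} × I_b/I_{b+1} → I_{a+b}/I_{a+b+1}`).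
[cite: AbramovichTemkinWlodarczyk2024, §3.4 (p. 1570) (the graded algebra A_γ = ⊕ I_m^γ)];
[cite: CossartJannsenSaito2020, §2.2 (p. 21) (in_𝔭, gr_𝔭(R))] -/
theorem weightedHomogeneousComponent_add_mul_of_le_monomialOrd (w : σ → ℕ)
    (P Q : MvPolynomial σ K) {a b : ℕ}
    (hP : (a : ℕ∞) ≤ monomialOrd w P) (hQ : (b : ℕ∞) ≤ monomialOrd w Q) :
    weightedHomogeneousComponent w (a + b) (P * Q) =
      weightedHomogeneousComponent w a P * weightedHomogeneousComponent w b Q := by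
  set Pa := weightedHomogeneousComponent w a P
  set Qb := weightedHomogeneousComponent w b Q
  have hPa : (a : ℕ∞) ≤ monomialOrd w Pa := le_monomialOrd_weightedHomogeneousComponent w P a
  have hP' := succ_le_monomialOrd_sub_weightedHomogeneousComponent w P hP
  have hQ' := succ_le_monomialOrd_sub_weightedHomogeneousComponent w Q hQ
  have hdec : P * Q = Pa * Qb + (Pa * (Q - Qb) + (P - Pa) * Q) := by ring
  have hE : ((a + b + 1 : ℕ) : ℕ∞) ≤ monomialOrd w (Pa * (Q - Qb) + (P - Pa) * Q) := by
    refine le_trans (le_min ?_ ?_) (min_monomialOrd_le_add _ _ _)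
    · refine le_trans ?_ (add_monomialOrd_le_mul _ _ _)
      calc ((a + b + 1 : ℕ) : ℕ∞) = (a : ℕ∞) + ((b + 1 : ℕ) : ℕ∞) := by push_cast; ring
        _ ≤ _ := add_le_add hPa hQ'
    · refine le_trans ?_ (add_monomialOrd_le_mul _ _ _)
      calc ((a + b + 1 : ℕ) : ℕ∞) = ((a + 1 : ℕ) : ℕ∞) + (b : ℕ∞) := by push_cast; ring
        _ ≤ _ := add_le_add hP' hQ
  rw [hdec, map_add,
    weightedHomogeneousComponent_eq_zero_of_lt_monomialOrd w _ (Nat.lt_succ_self _) hE, add_zero]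
  exact weightedHomogeneousComponent_eq_self
    ((weightedHomogeneousComponent_isWeightedHomogeneous a P).mul
      (weightedHomogeneousComponent_isWeightedHomogeneous b Q))

/-- Powers: `a ≤ ν_w P ⟹` the weight-`k·a` component of `P^k` is the `k`-th power of the
weight-`a` component. [cite: AbramovichTemkinWlodarczyk2024, §3.4 (p. 1570) (the graded algebra
A_γ)]; [cite: CossartJannsenSaito2020, §2.2 (p. 21) (gr_𝔭(R))] -/
theorem weightedHomogeneousComponent_mul_pow_of_le_monomialOrd (w : σ → ℕ) (P : MvPolynomial σ K)
    {a : ℕ} (hP : (a : ℕ∞) ≤ monomialOrd w P) (k : ℕ) :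
    weightedHomogeneousComponent w (k * a) (P ^ k) = weightedHomogeneousComponent w a P ^ k := by
  induction k with
  | zero =>
    rw [zero_mul, pow_zero, pow_zero]
    exact weightedHomogeneousComponent_eq_self (isWeightedHomogeneous_one K w)
  | succ k ih =>
    have hk : ((k * a : ℕ) : ℕ∞) ≤ monomialOrd w (P ^ k) := by
      refine le_trans ?_ (nsmul_monomialOrd_le_pow _ P k)
      rw [Nat.cast_mul, ← nsmul_eq_mul]
      exact nsmul_le_nsmul_right hP k
    rw [pow_succ, pow_succ, Nat.succ_mul,
      weightedHomogeneousComponent_add_mul_of_le_monomialOrd w _ _ hk hP, ih]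

/-- Finite products: the weight-`Σ aᵢ` component of `∏ Pᵢ` is the product of the weight-`aᵢ`
components when `aᵢ ≤ ν_w Pᵢ`. [cite: AbramovichTemkinWlodarczyk2024, §3.4 (p. 1570) (the graded
algebra A_γ)]; [cite: CossartJannsenSaito2020, §2.2 (p. 21) (gr_𝔭(R))] -/
theorem weightedHomogeneousComponent_sum_prod_of_le_monomialOrd (w : σ → ℕ) {ι : Type*}
    (s : Finset ι) (P : ι → MvPolynomial σ K) (a : ι → ℕ)
    (h : ∀ i ∈ s, (a i : ℕ∞) ≤ monomialOrd w (P i)) :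
    weightedHomogeneousComponent w (∑ i ∈ s, a i) (∏ i ∈ s, P i) =
      ∏ i ∈ s, weightedHomogeneousComponent w (a i) (P i) := by
  classical
  induction s using Finset.induction_on with
  | empty =>
    rw [Finset.sum_empty, Finset.prod_empty, Finset.prod_empty]
    exact weightedHomogeneousComponent_eq_self (isWeightedHomogeneous_one K w)
  | insert j s hjs ih =>
    have h' : ∀ i ∈ s, (a i : ℕ∞) ≤ monomialOrd w (P i) :=
      fun i hi => h i (Finset.mem_insert_of_mem hi)
    rw [Finset.sum_insert hjs, Finset.prod_insert hjs, Finset.prod_insert hjs,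
      weightedHomogeneousComponent_add_mul_of_le_monomialOrd w _ _ (h j (Finset.mem_insert_self j s))
        (sum_le_monomialOrd_finset_prod w s P a h'), ih h']

/-! ## §2 The graded substitution `θ_φ` and the layers of `φ G` up to the order -/

/-- A substitution of `w`-homogeneous polynomials of weights `wᵢ` for the `Xᵢ` is graded: it maps
`w`-homogeneous polynomials of weight `m` to `w`-homogeneous polynomials of weight `m`.
[cite: AbramovichTemkinWlodarczyk2024, §3.4 (p. 1570) (the graded algebra A_γ with generators
(xᵢ)T^{wᵢ})] -/
theorem isWeightedHomogeneous_aeval (w : σ → ℕ) (θ : σ → MvPolynomial σ K)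
    (hθ : ∀ i, IsWeightedHomogeneous w (θ i) (w i)) {P : MvPolynomial σ K} {m : ℕ}
    (hP : IsWeightedHomogeneous w P m) : IsWeightedHomogeneous w (aeval θ P) m := by
  classical
  have hexp : aeval θ P = ∑ d ∈ P.support, C (coeff d P) * ∏ i ∈ d.support, θ i ^ d i := by
    rw [MvPolynomial.aeval_def, MvPolynomial.eval₂_eq]
    simp only [MvPolynomial.algebraMap_eq]
  rw [hexp]
  refine IsWeightedHomogeneous.sum _ _ _ fun d hd => ?_
  have hwd : weight w d = m := hP (mem_support_iff.mp hd)
  have hπ : IsWeightedHomogeneous w (∏ i ∈ d.support, θ i ^ d i) (∑ i ∈ d.support, d i • w i) :=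
    IsWeightedHomogeneous.prod _ _ _ fun i _ => (hθ i).pow (d i)
  have hs : ∑ i ∈ d.support, d i • w i = m := by
    rw [← hwd, weight_eq_sum]
    simp only [smul_eq_mul]
  rw [hs] at hπ
  exact hπ.C_mul _

/-- **The layers of `φ G` up to the order only see the initial parts of the new parameters.**
Let `zᵢ = φ(Xᵢ)` dominate the weights, `wᵢ ≤ ν_w(zᵢ)`, and let `θ_φ : Xᵢ ↦` (weight-`wᵢ` component
of `zᵢ`).  Then for every `m ≤ ν_w(G)`:
`weightedHomogeneousComponent w m (φ G) = θ_φ (weightedHomogeneousComponent w m G)`.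
Proof: `φ G = Σ_d c_d ∏ zᵢ^{dᵢ}`; a monomial of weight `> m` contributes nothing in weight `m`
(its image lies in `I_{weight(d)}`, §1), one of weight `m` contributes `c_d ∏ (in zᵢ)^{dᵢ}`
(lowest components multiply, §1).  In particular (`m = ν_w G`): the weight-`ν_w(G)` layer of
`φ G` is `θ_φ(in_w G)` — it IS the initial form of `φ G` as soon as `ν_w(φ G) = ν_w(G)` (§3).
[cite: AbramovichTemkinWlodarczyk2024, Lemma 5.2.10 (p. 1577) and its proof, §3.4 (p. 1570)];
[cite: CossartJannsenSaito2020, §2.2 (p. 21) (in_𝔭(f) ∈ gr_𝔭(R))] -/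
theorem weightedHomogeneousComponent_map_of_le_monomialOrd (w : σ → ℕ)
    (φ : MvPolynomial σ K →ₐ[K] MvPolynomial σ K)
    (h : ∀ i, (w i : ℕ∞) ≤ monomialOrd w (φ (X i))) (G : MvPolynomial σ K) {m : ℕ}
    (hm : (m : ℕ∞) ≤ monomialOrd w G) :
    weightedHomogeneousComponent w m (φ G) =
      aeval (fun i => weightedHomogeneousComponent w (w i) (φ (X i)))
        (weightedHomogeneousComponent w m G) := by
  classical
  set θ : σ → MvPolynomial σ K := fun i => weightedHomogeneousComponent w (w i) (φ (X i)) with hθ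
  have hpow : ∀ (d : σ →₀ ℕ) (i : σ),
      ((d i * w i : ℕ) : ℕ∞) ≤ monomialOrd w (φ (X i) ^ d i) := fun d i => by
    refine le_trans ?_ (nsmul_monomialOrd_le_pow _ _ (d i))
    rw [Nat.cast_mul, ← nsmul_eq_mul]
    exact nsmul_le_nsmul_right (h i) (d i)
  have hge : ∀ d : σ →₀ ℕ,
      ((weight w d : ℕ) : ℕ∞) ≤ monomialOrd w (∏ i ∈ d.support, φ (X i) ^ d i) := fun d => by
    rw [weight_eq_sum]
    exact sum_le_monomialOrd_finset_prod w _ _ _ fun i _ => hpow d i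
  have hprod : ∀ d : σ →₀ ℕ,
      weightedHomogeneousComponent w (weight w d) (∏ i ∈ d.support, φ (X i) ^ d i) =
        ∏ i ∈ d.support, θ i ^ d i := fun d => by
    rw [weight_eq_sum,
      weightedHomogeneousComponent_sum_prod_of_le_monomialOrd w _ _ _ fun i _ => hpow d i]
    exact Finset.prod_congr rfl fun i _ =>
      weightedHomogeneousComponent_mul_pow_of_le_monomialOrd w _ (h i) (d i)
  have hexpφ : φ G = ∑ d ∈ G.support, C (coeff d G) * ∏ i ∈ d.support, φ (X i) ^ d i := by
    conv_lhs => rw [MvPolynomial.aeval_unique φ]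
    rw [MvPolynomial.aeval_def, MvPolynomial.eval₂_eq]
    simp only [MvPolynomial.algebraMap_eq, Function.comp_apply]
  have hexpθ : aeval θ (weightedHomogeneousComponent w m G) =
      ∑ d ∈ G.support with weight w d = m, C (coeff d G) * ∏ i ∈ d.support, θ i ^ d i := by
    rw [weightedHomogeneousComponent_apply, map_sum]
    refine Finset.sum_congr rfl fun d _ => ?_
    rw [aeval_monomial, MvPolynomial.algebraMap_eq]
    rfl
  rw [hexpφ, map_sum, hexpθ, Finset.sum_filter]
  refine Finset.sum_congr rfl fun d hd => ?_
  rw [weightedHomogeneousComponent_C_mul]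
  have hmd : m ≤ weight w d := (le_monomialOrd_iff w G m).mp hm d hd
  split_ifs with hdm
  · rw [← hdm, hprod]
  · rw [weightedHomogeneousComponent_eq_zero_of_lt_monomialOrd w _
      (lt_of_le_of_ne hmd (Ne.symm hdm)) (hge d), mul_zero]

/-- `θ_φ` is graded. [cite: AbramovichTemkinWlodarczyk2024, §3.4 (p. 1570)] -/
theorem isWeightedHomogeneous_aeval_initial (w : σ → ℕ)
    (φ : MvPolynomial σ K →ₐ[K] MvPolynomial σ K) {P : MvPolynomial σ K} {m : ℕ}
    (hP : IsWeightedHomogeneous w P m) :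
    IsWeightedHomogeneous w
      (aeval (fun i => weightedHomogeneousComponent w (w i) (φ (X i))) P) m :=
  isWeightedHomogeneous_aeval w _
    (fun i => weightedHomogeneousComponent_isWeightedHomogeneous (w i) (φ (X i))) hP

/-! ## §3 Automorphisms: `in_w(Ψ G) = θ_Ψ(in_w G)` and `θ_Ψ` is a graded automorphism -/

section GradedAutomorphism

variable [Finite σ] [IsNoetherianRing K] [IsDomain K]

/-- **Lemma (initial forms under a change of parameters of the centre).** For a `K`-algebra
automorphism `Ψ` of `K[X]` dominating the weights and `G` with `ν_w(G) = m`: `ν_w(Ψ G) = m`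
(rigidity) and `in_w(Ψ G) = θ_Ψ(in_w G)`.
[cite: AbramovichTemkinWlodarczyk2024, Lemma 5.2.10 (p. 1577), Thm. 5.3.1 (3) (p. 1578), §3.4
(p. 1570)] -/
theorem initialForm_ringEquiv (w : σ → ℕ) (Ψ : MvPolynomial σ K ≃ₐ[K] MvPolynomial σ K)
    (h : ∀ i, (w i : ℕ∞) ≤ monomialOrd w (Ψ (X i))) (G : MvPolynomial σ K) {m : ℕ}
    (hm : monomialOrd w G = m) :
    monomialOrd w (Ψ G) = m ∧
      weightedHomogeneousComponent w m (Ψ G) =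
        aeval (fun i => weightedHomogeneousComponent w (w i) (Ψ (X i)))
          (weightedHomogeneousComponent w m G) := by
  refine ⟨?_, ?_⟩
  · rw [← hm]
    exact monomialOrd_ringEquiv_eq w (Ψ : MvPolynomial σ K ≃+* MvPolynomial σ K) h G
  · have := weightedHomogeneousComponent_map_of_le_monomialOrd w
      (Ψ : MvPolynomial σ K →ₐ[K] MvPolynomial σ K) h G hm.ge
    simpa only [AlgEquiv.coe_toAlgHom] using this

/-- `θ_Ψ(θ_{Ψ⁻¹}(Xᵢ)) = Xᵢ`: apply §2 to `G = Ψ⁻¹(Xᵢ)` and `m = wᵢ` (`wᵢ ≤ ν_w(Ψ⁻¹ Xᵢ)` by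
rigidity, `monomialOrd_ringEquiv_symm_X`).
[cite: AbramovichTemkinWlodarczyk2024, Lemma 5.2.10 (p. 1577), Thm. 5.3.1 (3) (p. 1578)] -/
theorem aeval_initial_initial_symm_X (w : σ → ℕ) (Ψ : MvPolynomial σ K ≃ₐ[K] MvPolynomial σ K)
    (h : ∀ i, (w i : ℕ∞) ≤ monomialOrd w (Ψ (X i))) (i : σ) :
    aeval (fun j => weightedHomogeneousComponent w (w j) (Ψ (X j)))
      (weightedHomogeneousComponent w (w i) (Ψ.symm (X i))) = X i := by
  have hs : (w i : ℕ∞) ≤ monomialOrd w (Ψ.symm (X i)) :=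
    (monomialOrd_ringEquiv_symm_X w (Ψ : MvPolynomial σ K ≃+* MvPolynomial σ K) h i).ge
  have := weightedHomogeneousComponent_map_of_le_monomialOrd w
    (Ψ : MvPolynomial σ K →ₐ[K] MvPolynomial σ K) h (Ψ.symm (X i)) hs
  simp only [AlgEquiv.coe_toAlgHom, AlgEquiv.apply_symm_apply] at this
  rw [← this]
  exact weightedHomogeneousComponent_eq_self (isWeightedHomogeneous_X K w i)

/-- `θ_Ψ ∘ θ_{Ψ⁻¹} = id`. [cite: AbramovichTemkinWlodarczyk2024, Lemma 5.2.10 (p. 1577),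
Thm. 5.3.1 (3) (p. 1578)] -/
theorem aeval_initial_comp_symm (w : σ → ℕ) (Ψ : MvPolynomial σ K ≃ₐ[K] MvPolynomial σ K)
    (h : ∀ i, (w i : ℕ∞) ≤ monomialOrd w (Ψ (X i))) :
    (aeval (fun j => weightedHomogeneousComponent w (w j) (Ψ (X j)))).comp
        (aeval (fun j => weightedHomogeneousComponent w (w j) (Ψ.symm (X j)))) =
      AlgHom.id K (MvPolynomial σ K) := by
  refine MvPolynomial.algHom_ext fun i => ?_
  rw [AlgHom.comp_apply, aeval_X, AlgHom.id_apply]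
  exact aeval_initial_initial_symm_X w Ψ h i

/-- `θ_{Ψ⁻¹} ∘ θ_Ψ = id` (the hypothesis passes to `Ψ⁻¹` by rigidity).
[cite: AbramovichTemkinWlodarczyk2024, Lemma 5.2.10 (p. 1577), Thm. 5.3.1 (3) (p. 1578)] -/
theorem aeval_initial_symm_comp (w : σ → ℕ) (Ψ : MvPolynomial σ K ≃ₐ[K] MvPolynomial σ K)
    (h : ∀ i, (w i : ℕ∞) ≤ monomialOrd w (Ψ (X i))) :
    (aeval (fun j => weightedHomogeneousComponent w (w j) (Ψ.symm (X j)))).comp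
        (aeval (fun j => weightedHomogeneousComponent w (w j) (Ψ (X j)))) =
      AlgHom.id K (MvPolynomial σ K) := by
  have h' : ∀ i, (w i : ℕ∞) ≤ monomialOrd w (Ψ.symm (X i)) := fun i =>
    (monomialOrd_ringEquiv_symm_X w (Ψ : MvPolynomial σ K ≃+* MvPolynomial σ K) h i).ge
  simpa only [AlgEquiv.symm_symm] using aeval_initial_comp_symm w Ψ.symm h'

/-- **`θ_Ψ` is a graded `K`-algebra automorphism of `gr_J = K[X]` with inverse `θ_{Ψ⁻¹}`:** the
two presentations `(Xᵢ^{aᵢ})` and `(Ψ(Xᵢ)^{aᵢ})` of the (same, by rigidity) centre differ by a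
graded automorphism of its graded algebra.
[cite: AbramovichTemkinWlodarczyk2024, Thm. 5.3.1 (3) (p. 1578) ("J is the unique admissible
center … independent of the maximal contact sequence"), Lemma 5.2.10 (p. 1577), §3.4 (p. 1570)] -/
theorem exists_algEquiv_initial (w : σ → ℕ) (Ψ : MvPolynomial σ K ≃ₐ[K] MvPolynomial σ K)
    (h : ∀ i, (w i : ℕ∞) ≤ monomialOrd w (Ψ (X i))) :
    ∃ Θ : MvPolynomial σ K ≃ₐ[K] MvPolynomial σ K,
      (Θ : MvPolynomial σ K →ₐ[K] MvPolynomial σ K) =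
          aeval (fun j => weightedHomogeneousComponent w (w j) (Ψ (X j))) ∧
        (Θ.symm : MvPolynomial σ K →ₐ[K] MvPolynomial σ K) =
          aeval (fun j => weightedHomogeneousComponent w (w j) (Ψ.symm (X j))) ∧
        ∀ (P : MvPolynomial σ K) (m : ℕ), IsWeightedHomogeneous w P m →
          IsWeightedHomogeneous w (Θ P) m ∧ IsWeightedHomogeneous w (Θ.symm P) m :=
  ⟨AlgEquiv.ofAlgHom _ _ (aeval_initial_comp_symm w Ψ h) (aeval_initial_symm_comp w Ψ h),
    rfl, rfl, fun _ _ hP =>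
      ⟨isWeightedHomogeneous_aeval_initial w (Ψ : MvPolynomial σ K →ₐ[K] MvPolynomial σ K) hP,
        isWeightedHomogeneous_aeval_initial w
          (Ψ.symm : MvPolynomial σ K →ₐ[K] MvPolynomial σ K) hP⟩⟩

end GradedAutomorphism

/-! ## §4 Positive weights: `θ_Ψ` is block triangular with invertible linear blocks -/

/-- `P(0) = 0` ⟹ `1 ≤ ν_𝟙(P)`. [cite: CossartJannsenSaito2020, §2.2 (2.2) (p. 21)] -/
private theorem one_le_monomialOrd_one_of_constantCoeff (P : MvPolynomial σ K)
    (hP : constantCoeff P = 0) : (1 : ℕ∞) ≤ monomialOrd (fun _ => 1) P := by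
  rw [← Nat.cast_one, le_monomialOrd_iff]
  intro d hd
  rw [Nat.one_le_iff_ne_zero, ne_eq, ← Finsupp.degree_eq_weight_one, Finsupp.degree_eq_zero_iff]
  rintro rfl
  rw [MvPolynomial.mem_support_iff, ← constantCoeff_eq, hP] at hd
  exact hd rfl

/-- A component of non-zero weight has no constant term. [cite: AbramovichTemkinWlodarczyk2024,
§3.4 (p. 1570)] -/
theorem constantCoeff_weightedHomogeneousComponent_eq_zero (w : σ → ℕ) {c : ℕ} (hc : c ≠ 0)
    (P : MvPolynomial σ K) : constantCoeff (weightedHomogeneousComponent w c P) = 0 := by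
  classical
  show coeff 0 (weightedHomogeneousComponent w c P) = 0
  rw [coeff_weightedHomogeneousComponent, if_neg]
  rw [map_zero]
  exact Ne.symm hc

/-- **Shape of a monomial of weight `c` (all weights positive):** it is either a single variable
of weight `c`, or all its variables have weight `< c` (a variable of weight `≥ c` together with
anything else, or squared, exceeds `c`).  Hence the weight-`wᵢ` part of a new parameter is
(linear in the variables of weight `wᵢ`) + (polynomial in the variables of weight `< wᵢ`): `θ_φ`
is block triangular. [cite: AbramovichTemkinWlodarczyk2024, §3.4 (p. 1570) (I_m^γ = (x^b | Σ wᵢbᵢ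
≥ m)), proof of Thm. 5.3.1 (2)–(3) (p. 1578) ("x₁ ∈ (x'₁, …, x'_ℓ) + m_p²")] -/
theorem eq_single_or_forall_lt_of_weight_eq (w : σ → ℕ) (hw : ∀ i, 0 < w i) {d : σ →₀ ℕ}
    {c : ℕ} (hd : weight w d = c) :
    (∃ j, d = Finsupp.single j 1 ∧ w j = c) ∨ ∀ j ∈ d.support, w j < c := by
  classical
  by_cases H : ∃ j ∈ d.support, c ≤ w j
  · obtain ⟨j, hj, hcj⟩ := H
    left
    have hdj : 1 ≤ d j := Nat.one_le_iff_ne_zero.mpr (Finsupp.mem_support_iff.mp hj)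
    rw [weight_eq_sum] at hd
    have hle : d j * w j ≤ c := by
      rw [← hd]
      exact Finset.single_le_sum (f := fun i => d i * w i) (fun i _ => Nat.zero_le _) hj
    have h1 : w j ≤ d j * w j := Nat.le_mul_of_pos_left (w j) hdj
    have hwj : w j = c := le_antisymm (h1.trans hle) hcj
    have hdj1 : d j = 1 := by
      have h2 : d j * w j = 1 * w j := by
        rw [one_mul]
        exact le_antisymm (hwj ▸ hle) h1
      exact Nat.eq_of_mul_eq_mul_right (hw j) h2
    refine ⟨j, ?_, hwj⟩
    have hrest : ∑ i ∈ d.support.erase j, d i * w i = 0 := by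
      have h3 := Finset.add_sum_erase d.support (fun i => d i * w i) hj
      simp only [hdj1, one_mul] at h3
      omega
    rw [Finset.sum_eq_zero_iff] at hrest
    ext i
    by_cases hij : i = j
    · subst hij
      rw [Finsupp.single_eq_same, hdj1]
    · rw [Finsupp.single_apply, if_neg (fun h => hij h.symm)]
      by_contra hne
      have hi : i ∈ d.support.erase j :=
        Finset.mem_erase.mpr ⟨hij, Finsupp.mem_support_iff.mpr hne⟩
      rcases Nat.mul_eq_zero.mp (hrest i hi) with h0 | h0
      · exact hne h0
      · exact (hw i).ne' h0
  · right
    exact fun j hj => lt_of_not_ge fun hle => H ⟨j, hj, hle⟩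

/-- The monomials of the weight-`wᵢ` part of a new parameter: single variables of weight `wᵢ`, or
only variables of weight `< wᵢ`. [cite: AbramovichTemkinWlodarczyk2024, proof of Thm. 5.3.1
(2)–(3) (p. 1578), §3.4 (p. 1570)] -/
theorem support_initial_shape (w : σ → ℕ) (hw : ∀ i, 0 < w i) (P : MvPolynomial σ K) (c : ℕ)
    {d : σ →₀ ℕ} (hd : d ∈ (weightedHomogeneousComponent w c P).support) :
    (∃ j, d = Finsupp.single j 1 ∧ w j = c) ∨ ∀ j ∈ d.support, w j < c := by
  classical
  refine eq_single_or_forall_lt_of_weight_eq w hw ?_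
  rw [MvPolynomial.mem_support_iff, coeff_weightedHomogeneousComponent] at hd
  by_contra hne
  exact hd (if_neg hne)

/-- Linear parts compose: for substitutions without constant terms, the linear part of
`θ(Q)` is the linear substitution of the linear parts (§2 for the weights `𝟙`).
[cite: CossartJannsenSaito2020, §2.2 (p. 21) (in_𝔪, gr_𝔪(R))] -/
theorem weightedHomogeneousComponent_one_aeval (θ : σ → MvPolynomial σ K)
    (hθ : ∀ k, constantCoeff (θ k) = 0) (Q : MvPolynomial σ K) (hQ : constantCoeff Q = 0) :
    weightedHomogeneousComponent (fun _ => 1) 1 (aeval θ Q) =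
      aeval (fun k => weightedHomogeneousComponent (fun _ => 1) 1 (θ k))
        (weightedHomogeneousComponent (fun _ => 1) 1 Q) := by
  have h : ∀ i, (((fun _ => 1 : σ → ℕ) i : ℕ) : ℕ∞) ≤
      monomialOrd (fun _ => 1) ((aeval θ : MvPolynomial σ K →ₐ[K] MvPolynomial σ K) (X i)) :=
    fun i => by
      rw [aeval_X, Nat.cast_one]
      exact one_le_monomialOrd_one_of_constantCoeff _ (hθ i)
  have hm : ((1 : ℕ) : ℕ∞) ≤ monomialOrd (fun _ => 1) Q := by
    rw [Nat.cast_one]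
    exact one_le_monomialOrd_one_of_constantCoeff _ hQ
  have := weightedHomogeneousComponent_map_of_le_monomialOrd (fun _ => 1) (aeval θ) h Q hm
  simpa only [aeval_X] using this

/-- The block linear part, explicitly: the degree-`1` part of the weight-`c` part of `P` is
`Σ_{k : w_k = c} (∂P/∂X_k)(0)·X_k` — the row of the Jacobian at the origin cut down to the
variables of weight `c`. [cite: AbramovichTemkinWlodarczyk2024, proof of Thm. 5.3.1 (2)–(3)
(p. 1578) ("x₁ ∈ (x'₁, …, x'_ℓ) + m_p²"), §3.4 (p. 1570)] -/
theorem weightedHomogeneousComponent_one_weightedHomogeneousComponent [Fintype σ] [DecidableEq σ]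
    (w : σ → ℕ) (c : ℕ) (P : MvPolynomial σ K) :
    weightedHomogeneousComponent (fun _ => 1) 1 (weightedHomogeneousComponent w c P) =
      ∑ k ∈ Finset.univ.filter (fun k => w k = c), C (coeff (Finsupp.single k 1) P) * X k := by
  classical
  ext d
  simp only [coeff_weightedHomogeneousComponent, coeff_sum, coeff_C_mul, coeff_X]
  by_cases h1 : weight (fun _ => (1 : ℕ)) d = 1
  · rcases eq_single_or_forall_lt_of_weight_eq (fun _ => 1) (fun _ => Nat.one_pos) h1 with
      ⟨j, rfl, -⟩ | hlt
    · rw [if_pos h1, Finsupp.weight_single]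
      simp only [smul_eq_mul, one_mul]
      have : ∀ k, (if Finsupp.single k 1 = Finsupp.single j 1 then (1 : K) else 0) =
          if k = j then 1 else 0 := fun k => by
        simp only [Finsupp.single_left_inj one_ne_zero]
      simp only [this, mul_ite, mul_one, mul_zero, Finset.sum_ite_eq', Finset.mem_filter,
        Finset.mem_univ, true_and]
    · exfalso
      have hd0 : d = 0 := by
        ext j
        by_contra hne
        exact lt_irrefl 1 (hlt j (Finsupp.mem_support_iff.mpr hne))
      rw [hd0, map_zero] at h1
      exact zero_ne_one h1
  · rw [if_neg h1]
    symm
    refine Finset.sum_eq_zero fun k _ => ?_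
    rw [if_neg, mul_zero]
    rintro rfl
    exact h1 (by rw [Finsupp.weight_single, smul_eq_mul, mul_one])

section Blocks

variable [Finite σ] [IsNoetherianRing K] [IsDomain K]

/-- **The linear blocks of `θ_Ψ` and `θ_{Ψ⁻¹}` are mutually inverse** (all weights positive):
substituting the linear parts of the `θ_Ψ(X_k)` into the linear part of `θ_{Ψ⁻¹}(Xᵢ)` returns
`Xᵢ` — with `lin_c` as in `weightedHomogeneousComponent_one_weightedHomogeneousComponent`, the
Jacobian blocks `(∂(Ψ⁻¹Xᵢ)/∂X_k(0))_{w_i = w_k = c}` and `(∂(ΨX_k)/∂X_l(0))_{w_k = w_l = c}` multiply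
to the identity; in particular the linear map induced by `θ_Ψ` on the variables of each weight
is invertible.  [cite: AbramovichTemkinWlodarczyk2024, proof of Thm. 5.3.1 (2)–(3) (p. 1578)
("after reordering we get that (x₁, x'₂, …, x'_n) is a regular system of parameters"),
Lemma 5.2.10 (p. 1577)] -/
theorem aeval_linearPart_initial_symm_X (w : σ → ℕ) (hw : ∀ i, 0 < w i)
    (Ψ : MvPolynomial σ K ≃ₐ[K] MvPolynomial σ K)
    (h : ∀ i, (w i : ℕ∞) ≤ monomialOrd w (Ψ (X i))) (i : σ) :
    aeval (fun k => weightedHomogeneousComponent (fun _ => 1) 1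
        (weightedHomogeneousComponent w (w k) (Ψ (X k))))
      (weightedHomogeneousComponent (fun _ => 1) 1
        (weightedHomogeneousComponent w (w i) (Ψ.symm (X i)))) = X i := by
  have hθ : ∀ k, constantCoeff (weightedHomogeneousComponent w (w k) (Ψ (X k))) = 0 :=
    fun k => constantCoeff_weightedHomogeneousComponent_eq_zero w (hw k).ne' _
  have hQ : constantCoeff (weightedHomogeneousComponent w (w i) (Ψ.symm (X i))) = 0 :=
    constantCoeff_weightedHomogeneousComponent_eq_zero w (hw i).ne' _
  rw [← weightedHomogeneousComponent_one_aeval _ hθ _ hQ, aeval_initial_initial_symm_X w Ψ h i]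
  exact weightedHomogeneousComponent_eq_self (isWeightedHomogeneous_X K _ i)

/-- **Matrix form:** with `b_{ik} = ∂(Ψ⁻¹Xᵢ)/∂X_k(0)` and `a_{kl} = ∂(ΨX_k)/∂X_l(0)`, for `i, l` of
the same weight, `Σ_{k : w_k = w_i} b_{ik} a_{kl} = δ_{il}`: the weight-`c` diagonal blocks of the
Jacobian matrices of `Ψ⁻¹` and `Ψ` at the origin are mutually inverse (so each is invertible).
[cite: AbramovichTemkinWlodarczyk2024, proof of Thm. 5.3.1 (2)–(3) (p. 1578), Lemma 5.2.10
(p. 1577)] -/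
theorem sum_jacobianBlock_symm_mul_jacobianBlock [Fintype σ] [DecidableEq σ] (w : σ → ℕ)
    (hw : ∀ i, 0 < w i) (Ψ : MvPolynomial σ K ≃ₐ[K] MvPolynomial σ K)
    (h : ∀ i, (w i : ℕ∞) ≤ monomialOrd w (Ψ (X i))) {i l : σ} (hl : w l = w i) :
    ∑ k ∈ Finset.univ.filter (fun k => w k = w i),
        coeff (Finsupp.single k 1) (Ψ.symm (X i)) * coeff (Finsupp.single l 1) (Ψ (X k)) =
      if i = l then 1 else 0 := by
  have hid := aeval_linearPart_initial_symm_X w hw Ψ h i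
  simp only [weightedHomogeneousComponent_one_weightedHomogeneousComponent, map_sum, map_mul,
    aeval_C, aeval_X, MvPolynomial.algebraMap_eq] at hid
  have hc := congrArg (coeff (Finsupp.single l 1)) hid
  simp only [coeff_sum, coeff_C_mul, coeff_X, Finsupp.single_left_inj one_ne_zero] at hc
  rw [← hc]
  refine Finset.sum_congr rfl fun k hk => ?_
  rw [Finset.mem_filter] at hk
  congr 1
  simp only [mul_ite, mul_one, mul_zero]
  rw [Finset.sum_ite_eq', if_pos]
  rw [Finset.mem_filter]
  exact ⟨Finset.mem_univ _, hl.trans hk.2.symm⟩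

end Blocks

end WeightedBlowup

end Literature.AlgebraicGeometry.Resolution
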